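import Literature.Barriers.ValiantsHypothesis.FullRankMultilinearBaurStrassen
import Literature.Computability.AlgebraicComplexity.HrubesSensitiveMonotoneProofs
import Literature.Computability.AlgebraicComplexity.SyntacticMultilinearAppend
import HarnessLib

/-!
# Growing a syntactically multilinear gate list: availability with syntactic support

Raz–Yehudayoff (Comput. Complexity 17 (2008), §2) call an arithmetic circuit *syntactically
multilinear* if the two sons of every product gate have disjoint syntactic variable sets `X_v`
(the tree's `IsSyntacticallyMultilinear`, `SyntacticMultilinear.lean`; barrier-namespace twin in
`FullRankMultilinear.lean`, the two agree by `isSyntacticallyMultilinear_iff_algebraicComplexity`).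
This file is the bookkeeping needed to BUILD such circuits gate by gate, in the "growing plain gate
list" style of `HrubesSensitiveMonotoneProofs.lean` (namespace `Hrubes2020`: a polynomial `p` is
*available* in `gs` if some operand referring below `gs.length` evaluates to `p`):

* availability WITH SYNTACTIC SUPPORT — `∃ u, u.RefsBelow gs.length ∧ u.eval (gateValues gs) = p ∧
  operandVarSet (gateVarSets gs) u ⊆ V` — is monotone under extension (`savail_mono`), and holds
  for variables (`savail_X`, support `{i}`) and constants (`savail_C`, support `∅`);
* the product-gate invariant "every product gate of the list has operands with pairwise disjoint
  syntactic variable sets" (the gate-list form of `IsSyntacticallyMultilinear`,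
  `isSyntacticallyMultilinear_of_prodInv`) is preserved by appending a sum gate
  (`prodInv_append_sum`) and by appending a product gate whose two operands have disjoint
  supports (`prodInv_append_prod`);
* hence one appended gate makes `p + q` (support `V₁ ∪ V₂`), `p * q` (support `V₁ ∪ V₂`, PROVIDED
  `Disjoint V₁ V₂`) and `C c * p` (support `V`) available while keeping the list plain, fan-in-two
  and syntactically multilinear (`sextend_add`, `sextend_mul`, `sextend_smul`).

Companion of `SyntacticMultilinearAppend.lean` (namespace `SmAppend`: one-gate steps and the
stability lemma `operandVarSet_of_prefix`, reused here); this file adds the `∃`-packaged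
availability-with-support form, the raw product-gate invariant and the iteration lemma.
Consumer: the circuit half of `PerLeTripartition` (route `RyserTripartition` of the
`ValiantsHypothesis` tree: set-multilinear homogenisation and the sub-permanent tables must be
built syntactically multilinear).  No new definitions.

## References

* [RazYehudayoff2008] R. Raz, A. Yehudayoff, *Balancing syntactically multilinear arithmetic
  circuits*, Comput. Complexity 17 (2008), §2 (syntactic variable sets `X_v`, syntactically
  multilinear circuits).
* [JerrumSnir1982] M. Jerrum, M. Snir, J. ACM 29 (1982), §2.2 (plain gate-by-gate computations).
-/

namespace Literature.Computability.AlgebraicComplexity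

namespace SynAvail

open MvPolynomial ArithCircuit
open Literature.Barriers.ValiantsHypothesis (IsPlainGate)

universe u v

variable {k : Type u} {σ : Type v} [DecidableEq σ]

/-! ### Syntactic variable sets under extension of the gate list

The statements below use the `AlgebraicComplexity` copies of `operandVarSet` / `gateVarSet` /
`gateVarSets` (`SyntacticMultilinear.lean`); the list lemmas are transported from the
barrier-namespace twins (`FullRankMultilinear*.lean`) through `gateVarSets_eq_algebraicComplexity`. -/

/-- One step of the left fold `gateVarSets`. [cite: RazYehudayoff2008, §2] -/
private theorem gateVarSets_append_singleton (gs : List (Gate k σ)) (g : Gate k σ) :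
    gateVarSets (gs ++ [g]) = gateVarSets gs ++ [gateVarSet (gateVarSets gs) g] := by
  simp [gateVarSets, List.foldl_append]

/-- `gateVarSets` has one entry per gate. [cite: RazYehudayoff2008, §2] -/
private theorem length_gateVarSets (gs : List (Gate k σ)) : (gateVarSets gs).length = gs.length := by
  rw [← Literature.Barriers.ValiantsHypothesis.gateVarSets_eq_algebraicComplexity]
  exact Literature.Barriers.ValiantsHypothesis.RazYehudayoff.length_gateVarSets gs

/-- Membership in the variable set of a gate: in the variable set of one of its operands.
[cite: RazYehudayoff2008, §2] -/
private theorem mem_gateVarSet_iff (vs : List (Finset σ)) (g : Gate k σ) (x : σ) :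
    x ∈ gateVarSet vs g ↔ ∃ u ∈ g.args, x ∈ operandVarSet vs u := by
  rw [← Literature.Barriers.ValiantsHypothesis.gateVarSet_eq_algebraicComplexity,
    Literature.Barriers.ValiantsHypothesis.AKV.mem_gateVarSet_iff]
  simp only [Literature.Barriers.ValiantsHypothesis.operandVarSet_eq_algebraicComplexity]

variable [CommSemiring k]

/-! ### Availability with syntactic support -/

/-- Availability with syntactic support is monotone under extension of the gate list.
[cite: RazYehudayoff2008, §2] -/
theorem savail_mono {gs gs' : List (Gate k σ)} (h : gs <+: gs') {p : MvPolynomial σ k}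
    {V : Finset σ}
    (hp : ∃ u : Operand k σ, u.RefsBelow gs.length ∧ u.eval (gateValues gs) = p ∧
      operandVarSet (gateVarSets gs) u ⊆ V) :
    ∃ u : Operand k σ, u.RefsBelow gs'.length ∧ u.eval (gateValues gs') = p ∧
      operandVarSet (gateVarSets gs') u ⊆ V := by
  obtain ⟨u, hu, rfl, hV⟩ := hp
  exact ⟨u, Hrubes2020.refsBelow_mono h.length_le hu, Hrubes2020.operand_eval_of_prefix h hu,
    by rwa [SmAppend.operandVarSet_of_prefix h hu]⟩

/-- Weakening the support bound. [cite: RazYehudayoff2008, §2] -/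
theorem savail_weaken {gs : List (Gate k σ)} {p : MvPolynomial σ k} {V W : Finset σ} (hVW : V ⊆ W)
    (hp : ∃ u : Operand k σ, u.RefsBelow gs.length ∧ u.eval (gateValues gs) = p ∧
      operandVarSet (gateVarSets gs) u ⊆ V) :
    ∃ u : Operand k σ, u.RefsBelow gs.length ∧ u.eval (gateValues gs) = p ∧
      operandVarSet (gateVarSets gs) u ⊆ W := by
  obtain ⟨u, hu, hp, hV⟩ := hp
  exact ⟨u, hu, hp, hV.trans hVW⟩

/-- A variable is available for free, with syntactic support `{i}`. [cite: RazYehudayoff2008, §2] -/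
theorem savail_X (gs : List (Gate k σ)) (i : σ) {V : Finset σ} (hi : i ∈ V) :
    ∃ u : Operand k σ, u.RefsBelow gs.length ∧ u.eval (gateValues gs) = X i ∧
      operandVarSet (gateVarSets gs) u ⊆ V :=
  ⟨.var i, trivial, rfl, by simpa [operandVarSet] using hi⟩

/-- A constant is available for free, with empty syntactic support. [cite: RazYehudayoff2008, §2] -/
theorem savail_C (gs : List (Gate k σ)) (c : k) (V : Finset σ) :
    ∃ u : Operand k σ, u.RefsBelow gs.length ∧ u.eval (gateValues gs) = C c ∧
      operandVarSet (gateVarSets gs) u ⊆ V :=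
  ⟨.const c, trivial, rfl, by simp [operandVarSet]⟩

/-! ### The product-gate invariant -/

omit [CommSemiring k] in
/-- The empty gate list satisfies the product-gate invariant. [cite: RazYehudayoff2008, §2] -/
theorem prodInv_nil :
    ∀ (i : ℕ) (args : List (Operand k σ)), ([] : List (Gate k σ))[i]? = some (.prod args) →
      (args.map (operandVarSet (gateVarSets (([] : List (Gate k σ)).take i)))).Pairwise
        Disjoint := by
  intro i args h
  simp at h

omit [CommSemiring k] in
/-- Appending a SUM gate preserves the product-gate invariant. [cite: RazYehudayoff2008, §2] -/
theorem prodInv_append_sum {gs : List (Gate k σ)}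
    (hml : ∀ (i : ℕ) (args : List (Operand k σ)), gs[i]? = some (.prod args) →
      (args.map (operandVarSet (gateVarSets (gs.take i)))).Pairwise Disjoint)
    (l : List (k × Operand k σ)) :
    ∀ (i : ℕ) (args : List (Operand k σ)), (gs ++ [Gate.sum l])[i]? = some (.prod args) →
      (args.map (operandVarSet (gateVarSets ((gs ++ [Gate.sum l]).take i)))).Pairwise
        Disjoint := by
  intro i args hi
  rcases Nat.lt_or_ge i gs.length with h | h
  · rw [List.getElem?_append_left h] at hi
    rw [List.take_append_of_le_length h.le]
    exact hml i args hi
  · rcases Nat.eq_or_lt_of_le h with h | h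
    · subst h
      simp at hi
    · rw [List.getElem?_eq_none (by simp; omega)] at hi
      exact absurd hi (by simp)

omit [CommSemiring k] in
/-- Appending a PRODUCT gate whose two operands have disjoint syntactic variable sets preserves
the product-gate invariant. [cite: RazYehudayoff2008, §2] -/
theorem prodInv_append_prod {gs : List (Gate k σ)}
    (hml : ∀ (i : ℕ) (args : List (Operand k σ)), gs[i]? = some (.prod args) →
      (args.map (operandVarSet (gateVarSets (gs.take i)))).Pairwise Disjoint)
    {u w : Operand k σ}
    (huw : Disjoint (operandVarSet (gateVarSets gs) u) (operandVarSet (gateVarSets gs) w)) :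
    ∀ (i : ℕ) (args : List (Operand k σ)), (gs ++ [Gate.prod [u, w]])[i]? = some (.prod args) →
      (args.map (operandVarSet (gateVarSets ((gs ++ [Gate.prod [u, w]]).take i)))).Pairwise
        Disjoint := by
  intro i args hi
  rcases Nat.lt_or_ge i gs.length with h | h
  · rw [List.getElem?_append_left h] at hi
    rw [List.take_append_of_le_length h.le]
    exact hml i args hi
  · rcases Nat.eq_or_lt_of_le h with h | h
    · subst h
      simp only [List.getElem?_append_right le_rfl, Nat.sub_self, List.getElem?_cons_zero,
        Option.some.injEq, Gate.prod.injEq] at hi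
      subst hi
      rw [List.take_left']
      · simpa using huw
      · rfl
    · rw [List.getElem?_eq_none (by simp; omega)] at hi
      exact absurd hi (by simp)

omit [CommSemiring k] in
/-- **A gate list satisfying the product-gate invariant is a syntactically multilinear circuit**
(for any output operand), in the tree's `IsSyntacticallyMultilinear` (the `AlgebraicComplexity`
copy, via `isSyntacticallyMultilinear_iff_algebraicComplexity`). [cite: RazYehudayoff2008, §2] -/
theorem isSyntacticallyMultilinear_of_prodInv {gs : List (Gate k σ)}
    (hml : ∀ (i : ℕ) (args : List (Operand k σ)), gs[i]? = some (.prod args) →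
      (args.map (operandVarSet (gateVarSets (gs.take i)))).Pairwise Disjoint)
    (out : Operand k σ) :
    IsSyntacticallyMultilinear (⟨gs, out⟩ : ArithCircuit k σ) :=
  hml

/-! ### Extension steps -/

/-- One plain ADDITION gate: `p + q` becomes available with support `V₁ ∪ V₂`; the list stays plain,
fan-in-two and syntactically multilinear. [cite: RazYehudayoff2008, §2] -/
theorem sextend_add {gs : List (Gate k σ)} {p q : MvPolynomial σ k} {V₁ V₂ : Finset σ}
    (hgs : ∀ g ∈ gs, g.fanIn ≤ 2 ∧ IsPlainGate g)
    (hml : ∀ (i : ℕ) (args : List (Operand k σ)), gs[i]? = some (.prod args) →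
      (args.map (operandVarSet (gateVarSets (gs.take i)))).Pairwise Disjoint)
    (hp : ∃ u : Operand k σ, u.RefsBelow gs.length ∧ u.eval (gateValues gs) = p ∧
      operandVarSet (gateVarSets gs) u ⊆ V₁)
    (hq : ∃ u : Operand k σ, u.RefsBelow gs.length ∧ u.eval (gateValues gs) = q ∧
      operandVarSet (gateVarSets gs) u ⊆ V₂) :
    ∃ gs' : List (Gate k σ), gs <+: gs' ∧ (∀ g ∈ gs', g.fanIn ≤ 2 ∧ IsPlainGate g) ∧
      (∀ (i : ℕ) (args : List (Operand k σ)), gs'[i]? = some (.prod args) →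
        (args.map (operandVarSet (gateVarSets (gs'.take i)))).Pairwise Disjoint) ∧
      gs'.length ≤ gs.length + 1 ∧
      ∃ u : Operand k σ, u.RefsBelow gs'.length ∧ u.eval (gateValues gs') = p + q ∧
        operandVarSet (gateVarSets gs') u ⊆ V₁ ∪ V₂ := by
  obtain ⟨up, hup, rfl, hVp⟩ := hp
  obtain ⟨uq, huq, rfl, hVq⟩ := hq
  refine ⟨gs ++ [Gate.sum [(1, up), (1, uq)]], List.prefix_append _ _, ?_,
    prodInv_append_sum hml _, by simp, .gate gs.length, ?_, ?_, ?_⟩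
  · intro g hg
    rw [List.mem_append, List.mem_singleton] at hg
    rcases hg with hg | rfl
    · exact hgs g hg
    · exact ⟨by simp [Gate.fanIn, Gate.args], by simp [IsPlainGate]⟩
  · simp [Operand.RefsBelow]
  · rw [gateValues_append_singleton]
    have hl := gateValues_length (k := k) gs
    simp [Operand.eval, List.getD_eq_getElem?_getD, Gate.eval, hl]
  · rw [gateVarSets_append_singleton]
    have hl := length_gateVarSets (k := k) gs
    simp only [operandVarSet, List.getD_eq_getElem?_getD, List.getElem?_append_right (le_of_eq hl),
      hl, Nat.sub_self, List.getElem?_cons_zero, Option.getD_some]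
    intro x hx
    rw [mem_gateVarSet_iff] at hx
    obtain ⟨u, hu, hx⟩ := hx
    simp only [Gate.args, List.mem_map, List.mem_cons, List.not_mem_nil, or_false] at hu
    obtain ⟨cu, hcu, rfl⟩ := hu
    rcases hcu with h | h <;> cases h
    · exact Finset.mem_union_left _ (hVp hx)
    · exact Finset.mem_union_right _ (hVq hx)

/-- One PRODUCT gate with operands of DISJOINT supports: `p * q` becomes available with support
`V₁ ∪ V₂`; the list stays plain, fan-in-two and syntactically multilinear. [cite: RazYehudayoff2008, §2] -/
theorem sextend_mul {gs : List (Gate k σ)} {p q : MvPolynomial σ k} {V₁ V₂ : Finset σ}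
    (hgs : ∀ g ∈ gs, g.fanIn ≤ 2 ∧ IsPlainGate g)
    (hml : ∀ (i : ℕ) (args : List (Operand k σ)), gs[i]? = some (.prod args) →
      (args.map (operandVarSet (gateVarSets (gs.take i)))).Pairwise Disjoint)
    (hV : Disjoint V₁ V₂)
    (hp : ∃ u : Operand k σ, u.RefsBelow gs.length ∧ u.eval (gateValues gs) = p ∧
      operandVarSet (gateVarSets gs) u ⊆ V₁)
    (hq : ∃ u : Operand k σ, u.RefsBelow gs.length ∧ u.eval (gateValues gs) = q ∧
      operandVarSet (gateVarSets gs) u ⊆ V₂) :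
    ∃ gs' : List (Gate k σ), gs <+: gs' ∧ (∀ g ∈ gs', g.fanIn ≤ 2 ∧ IsPlainGate g) ∧
      (∀ (i : ℕ) (args : List (Operand k σ)), gs'[i]? = some (.prod args) →
        (args.map (operandVarSet (gateVarSets (gs'.take i)))).Pairwise Disjoint) ∧
      gs'.length ≤ gs.length + 1 ∧
      ∃ u : Operand k σ, u.RefsBelow gs'.length ∧ u.eval (gateValues gs') = p * q ∧
        operandVarSet (gateVarSets gs') u ⊆ V₁ ∪ V₂ := by
  obtain ⟨up, hup, rfl, hVp⟩ := hp
  obtain ⟨uq, huq, rfl, hVq⟩ := hq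
  refine ⟨gs ++ [Gate.prod [up, uq]], List.prefix_append _ _, ?_,
    prodInv_append_prod hml (hV.mono hVp hVq), by simp, .gate gs.length, ?_, ?_, ?_⟩
  · intro g hg
    rw [List.mem_append, List.mem_singleton] at hg
    rcases hg with hg | rfl
    · exact hgs g hg
    · exact ⟨by simp [Gate.fanIn, Gate.args], by simp [IsPlainGate]⟩
  · simp [Operand.RefsBelow]
  · rw [gateValues_append_singleton]
    have hl := gateValues_length (k := k) gs
    simp [Operand.eval, List.getD_eq_getElem?_getD, Gate.eval, hl]
  · rw [gateVarSets_append_singleton]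
    have hl := length_gateVarSets (k := k) gs
    simp only [operandVarSet, List.getD_eq_getElem?_getD, List.getElem?_append_right (le_of_eq hl),
      hl, Nat.sub_self, List.getElem?_cons_zero, Option.getD_some]
    intro x hx
    rw [mem_gateVarSet_iff] at hx
    obtain ⟨u, hu, hx⟩ := hx
    simp only [Gate.args, List.mem_cons, List.not_mem_nil, or_false] at hu
    rcases hu with rfl | rfl
    · exact Finset.mem_union_left _ (hVp hx)
    · exact Finset.mem_union_right _ (hVq hx)

/-- Scalar multiplication by a constant: a product gate with a constant operand (empty support);
the support of `C c * p` is that of `p`. [cite: JerrumSnir1982, §2.2] -/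
theorem sextend_smul {gs : List (Gate k σ)} (c : k) {p : MvPolynomial σ k} {V : Finset σ}
    (hgs : ∀ g ∈ gs, g.fanIn ≤ 2 ∧ IsPlainGate g)
    (hml : ∀ (i : ℕ) (args : List (Operand k σ)), gs[i]? = some (.prod args) →
      (args.map (operandVarSet (gateVarSets (gs.take i)))).Pairwise Disjoint)
    (hp : ∃ u : Operand k σ, u.RefsBelow gs.length ∧ u.eval (gateValues gs) = p ∧
      operandVarSet (gateVarSets gs) u ⊆ V) :
    ∃ gs' : List (Gate k σ), gs <+: gs' ∧ (∀ g ∈ gs', g.fanIn ≤ 2 ∧ IsPlainGate g) ∧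
      (∀ (i : ℕ) (args : List (Operand k σ)), gs'[i]? = some (.prod args) →
        (args.map (operandVarSet (gateVarSets (gs'.take i)))).Pairwise Disjoint) ∧
      gs'.length ≤ gs.length + 1 ∧
      ∃ u : Operand k σ, u.RefsBelow gs'.length ∧ u.eval (gateValues gs') = C c * p ∧
        operandVarSet (gateVarSets gs') u ⊆ V := by
  have h := sextend_mul hgs hml (Finset.disjoint_empty_left V) (savail_C gs c ∅) hp
  simpa only [Finset.empty_union] using h

/-! ### Iteration -/

/-- Sequential iteration of extension steps keeping the list plain, fan-in-two AND syntactically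
multilinear (the analogue of `Hrubes2020.iterate_extend` with the product-gate invariant in the
loop invariant): `cost * m` gates make all targets `Q l`, `l < m`, hold. [cite: JerrumSnir1982, §2.2] -/
theorem siterate_extend (Q : ℕ → List (Gate k σ) → Prop)
    (hQ : ∀ l (gs₁ gs₂ : List (Gate k σ)), gs₁ <+: gs₂ → Q l gs₁ → Q l gs₂) (cost : ℕ)
    (gs : List (Gate k σ)) (hgs : ∀ g ∈ gs, g.fanIn ≤ 2 ∧ IsPlainGate g)
    (hml : ∀ (i : ℕ) (args : List (Operand k σ)), gs[i]? = some (.prod args) →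
      (args.map (operandVarSet (gateVarSets (gs.take i)))).Pairwise Disjoint) :
    ∀ m : ℕ,
    (∀ l < m, ∀ gs' : List (Gate k σ), gs <+: gs' → (∀ g ∈ gs', g.fanIn ≤ 2 ∧ IsPlainGate g) →
      (∀ (i : ℕ) (args : List (Operand k σ)), gs'[i]? = some (.prod args) →
        (args.map (operandVarSet (gateVarSets (gs'.take i)))).Pairwise Disjoint) →
      (∀ l' < l, Q l' gs') →
      ∃ gs'' : List (Gate k σ), gs' <+: gs'' ∧ (∀ g ∈ gs'', g.fanIn ≤ 2 ∧ IsPlainGate g) ∧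
        (∀ (i : ℕ) (args : List (Operand k σ)), gs''[i]? = some (.prod args) →
          (args.map (operandVarSet (gateVarSets (gs''.take i)))).Pairwise Disjoint) ∧
        gs''.length ≤ gs'.length + cost ∧ Q l gs'') →
    ∃ gs' : List (Gate k σ), gs <+: gs' ∧ (∀ g ∈ gs', g.fanIn ≤ 2 ∧ IsPlainGate g) ∧
      (∀ (i : ℕ) (args : List (Operand k σ)), gs'[i]? = some (.prod args) →
        (args.map (operandVarSet (gateVarSets (gs'.take i)))).Pairwise Disjoint) ∧
      gs'.length ≤ gs.length + cost * m ∧ ∀ l < m, Q l gs' := by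
  intro m
  induction m with
  | zero =>
    intro _
    exact ⟨gs, List.prefix_rfl, hgs, hml, by simp, fun l hl => absurd hl (Nat.not_lt_zero l)⟩
  | succ m ih =>
    intro h
    obtain ⟨gs₁, hpre₁, hgood₁, hml₁, hlen₁, hQ₁⟩ :=
      ih fun l hl gs' hp hg hm hQ' => h l (Nat.lt_succ_of_lt hl) gs' hp hg hm hQ'
    obtain ⟨gs₂, hpre₂, hgood₂, hml₂, hlen₂, hQ₂⟩ :=
      h m (Nat.lt_succ_self m) gs₁ hpre₁ hgood₁ hml₁ hQ₁
    refine ⟨gs₂, hpre₁.trans hpre₂, hgood₂, hml₂, ?_, fun l hl => ?_⟩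
    · rw [Nat.mul_succ]; omega
    · rcases Nat.lt_succ_iff_lt_or_eq.mp hl with hl | rfl
      · exact hQ l gs₁ gs₂ hpre₂ (hQ₁ l hl)
      · exact hQ₂

end SynAvail

end Literature.Computability.AlgebraicComplexity
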